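import Summits.SmoothPoincare4.SmoothPoincare4.Theorems.DottedCircleRasmussenDcrGapHelperFriendsCarrierVkPartAPartIPicture
import Summits.SmoothPoincare4.SmoothPoincare4.Theorems.DottedCircleRasmussenDcrGapHelperFriendsCarrierVkPartAPartILoops

/-!
# Helper `helper_friendsCarrier_Vk_partA_partI` (V_k part A, part I: the tube framing is the Seifert
framing), piece 7: the values of the detecting functionals on the collar generators
(line `mk_friends`, crux `DcrGap`; item stmt-SmoothPoincare4-16128, route route-SmoothPoincare4-DottedCircleRasmussen)

The Mayer–Vietoris bookkeeping of part I evaluates three kinds of functionals `W → ℂ ∖ 0` on the collar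
`W = P(M_k ∩ {0 < |w|² < ε})` — the axis functional and the revolution functionals of piece 5 (restricted from
`O ⊇ W`) and the planar windings `z − c_j` — on the four kinds of generating loops of pieces 2–3 (core-parallel
loops and fibre circles, far and near).  This file computes the winding functional `windH` of the resulting
classes of `H₁(ℂ ∖ 0; ℤ)` from the value formulas: `2πi` for the axis functional on the far core-parallel loop and
for the winding about `c_j` on the near core-parallel loop of the hole `j`, `−2πi` for the revolution functional of
the hole `j` on its fibre circle, and `0` (constant or convex-valued loops) in the remaining cases that matter.

* `FriendsCarrierVk.geo_*` — the evaluations;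
* `helper_friendsCarrier_Vk_partA_partI_geoValues` — the registered statement (three representative cases).

No definitions, no named facts, no `sorry`.

## References

* A. Hatcher, *Algebraic Topology*, CUP (2002), §2.2, Thm. 2A.1. [HatcherAT2002]
* R. Kirby, *The Topology of 4-Manifolds*, LNM 1374 (1989), Ch. I §2. [Kirby1989]
-/

set_option linter.dupNamespace false
set_option linter.style.longLine false

noncomputable section

open scoped Manifold ContDiff Topology ComplexConjugate unitInterval
open Function Set Metric TopologicalSpace Literature.Topology.FourManifolds Literature.Topology.FourManifolds.MMSW Literature.AlgebraicTopology.Homotopy.HopfFibration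
  Literature.AlgebraicTopology.SingularHomology Literature.AlgebraicTopology.FundamentalGroup.PuncturedPlane

namespace Summit.SmoothPoincare4.SmoothPoincare4.Theorems.DcrGap.MkFriends

namespace FriendsCarrierVk

variable {k : ℕ} {ε : ℝ} {W O : Set (sphere (0 : EuclideanSpace ℝ (Fin 4)) 1)}

/-! ## Generic evaluations -/

/-- The class of a loop of `W` under a functional whose values along it have constant angular speed `m` has
winding `2πim`. [cite: HatcherAT2002, Thm. 1.7] -/
theorem geo_windH_of_arg (Φ : C(↥W, CStar)) {q : ↥W} (γ : Path q q) (m : ℤ)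
    (h : ∀ t : I, ((Φ (γ t) : CStar) : ℂ) = ((‖((Φ (γ t) : CStar) : ℂ)‖ : ℝ) : ℂ) * Complex.exp (((2 * Real.pi * m * t : ℝ) : ℂ) * Complex.I)) :
    windH (singularHomology.map ℤ ℤ Φ 1 (loopClass ℤ ℤ (1 : ℤ) γ)) = 2 * Real.pi * m * Complex.I := by
  rw [map_loopClass]; exact windH_loopClass_of_arg _ m h

/-- The class of a loop of `W` under a functional constant along it vanishes. [folklore] -/
theorem geo_map_eq_zero_of_const (Φ : C(↥W, CStar)) {q : ↥W} (γ : Path q q) (c : ℂ)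
    (h : ∀ t : I, ((Φ (γ t) : CStar) : ℂ) = c) : singularHomology.map ℤ ℤ Φ 1 (loopClass ℤ ℤ (1 : ℤ) γ) = 0 := by
  rw [map_loopClass]
  refine loopClass_eq_zero_of_const' _ fun t => Subtype.ext ?_
  rw [Path.map_coe, Function.comp_apply, h t, ← h 0, γ.source]

/-- The class of a loop of `W` under a functional with values along it in a convex set missing `0` vanishes.
[folklore] -/
theorem geo_map_eq_zero_of_convex (Φ : C(↥W, CStar)) {q : ↥W} (γ : Path q q) (K : Set ℂ) (hK : Convex ℝ K)
    (h0 : (0 : ℂ) ∉ K) (h : ∀ t : I, ((Φ (γ t) : CStar) : ℂ) ∈ K) : singularHomology.map ℤ ℤ Φ 1 (loopClass ℤ ℤ (1 : ℤ) γ) = 0 := by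
  rw [map_loopClass]; exact loopClass_eq_zero_of_convex _ K hK h0 fun t => h t

/-- Reading a restricted functional at a picture point of `W`. [folklore] -/
theorem geo_comp_apply (hWO : W ⊆ O) (f : C(↥O, CStar)) {y : ↥W} {x : EuclideanSpace ℝ (Fin 4)}
    (hy : ((y : ↥W) : sphere (0 : EuclideanSpace ℝ (Fin 4)) 1) = stereoNorthInv (draw k x)) :
    ∃ hxO : stereoNorthInv (draw k x) ∈ O, (((f.comp (subsetInclusion hWO)) y : CStar) : ℂ) = ((f ⟨stereoNorthInv (draw k x), hxO⟩ : CStar) : ℂ) := by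
  have hxW : stereoNorthInv (draw k x) ∈ W := by rw [← hy]; exact y.2
  refine ⟨hWO hxW, ?_⟩
  have : subsetInclusion hWO y = ⟨stereoNorthInv (draw k x), hWO hxW⟩ := Subtype.ext hy
  rw [ContinuousMap.comp_apply, this]

/-- `√ε/2` as a complex number is a non-zero point of the positive axis. [folklore] -/
theorem geo_half_sqrt (hε : 0 < ε) : ((Real.sqrt ε / 2 : ℝ) : ℂ) ≠ 0 ∧ unitDir 0 ((Real.sqrt ε / 2 : ℝ) : ℂ) = 1 ∧
    ∀ t : ℝ, unitDir 0 (((Real.sqrt ε / 2 : ℝ) : ℂ) * Complex.exp ((t : ℂ) * Complex.I)) = Complex.exp ((t : ℂ) * Complex.I) ∧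
      ((Real.sqrt ε / 2 : ℝ) : ℂ) * Complex.exp ((t : ℂ) * Complex.I) ≠ 0 := by
  have hs : 0 < Real.sqrt ε / 2 := by positivity
  have h1 : unitDir 0 ((Real.sqrt ε / 2 : ℝ) : ℂ) = 1 := by
    have := unitDir_ray (c := 0) (v := 1) (by simp) hs; rwa [zero_add, mul_one] at this
  refine ⟨by exact_mod_cast hs.ne', h1, fun t => ⟨?_, mul_ne_zero (by exact_mod_cast hs.ne') (Complex.exp_ne_zero _)⟩⟩
  have := unitDir_ray (c := 0) (v := Complex.exp ((t : ℂ) * Complex.I)) (by rw [Complex.norm_exp_ofReal_mul_I]) hs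
  rwa [zero_add] at this

/-! ## The axis functional -/

/-- **Axis functional on the far core-parallel loop: winding `2πi`.** [cite: HatcherAT2002, §2.2] -/
theorem geo_axis_farPar (hε : 0 < ε) (hWO : W ⊆ O) (f₀ : C(↥O, CStar))
    (hf₀ : ∀ (x : EuclideanSpace ℝ (Fin 4)) (hxO : stereoNorthInv (draw k x) ∈ O), x ∈ modelBoundary k → wC x ≠ 0 →
      (20 * ((k : ℝ) + 1) < ‖zC x‖ → ((f₀ ⟨stereoNorthInv (draw k x), hxO⟩ : CStar) : ℂ) = toC (coLatDir k (zC x))) ∧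
      ((∃ j : Fin k, ‖zC x - holeCentre k j‖ < 27 / 20) → ((f₀ ⟨stereoNorthInv (draw k x), hxO⟩ : CStar) : ℂ) = 1))
    {q : ↥W} (γ : Path q q)
    (hγ : ∀ t : I, ∃ z : ℂ, 20 * ((k : ℝ) + 1) < ‖z‖ ∧ coLatDir k z = toE2 (Complex.exp ((2 * Real.pi * t : ℝ) * Complex.I)) ∧
      ofZW z ((Real.sqrt ε / 2 : ℝ) : ℂ) ∈ modelBoundary k ∧ ((γ t : ↥W) : sphere (0 : EuclideanSpace ℝ (Fin 4)) 1) = stereoNorthInv (draw k (ofZW z ((Real.sqrt ε / 2 : ℝ) : ℂ)))) :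
    windH (singularHomology.map ℤ ℤ (f₀.comp (subsetInclusion hWO)) 1 (loopClass ℤ ℤ (1 : ℤ) γ)) = 2 * Real.pi * Complex.I := by
  have h := geo_windH_of_arg (f₀.comp (subsetInclusion hWO)) γ 1 fun t => ?_
  · rw [h]; push_cast; ring
  obtain ⟨z, hfar, hdir, hM, hval⟩ := hγ t
  obtain ⟨hxO, e⟩ := geo_comp_apply hWO f₀ hval
  have hw : wC (ofZW z ((Real.sqrt ε / 2 : ℝ) : ℂ)) ≠ 0 := by rw [wC_ofZW]; exact (geo_half_sqrt hε).1
  have hv := (hf₀ _ hxO hM hw).1 (by rw [zC_ofZW]; exact hfar)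
  rw [zC_ofZW, hdir, toC_toE2] at hv
  rw [e, hv, Complex.norm_exp_ofReal_mul_I]; push_cast; ring_nf

/-- **Axis functional on a loop of pictures of near points: `0`** (the functional is `1` there). [folklore] -/
theorem geo_axis_near (hWO : W ⊆ O) (f₀ : C(↥O, CStar))
    (hf₀ : ∀ (x : EuclideanSpace ℝ (Fin 4)) (hxO : stereoNorthInv (draw k x) ∈ O), x ∈ modelBoundary k → wC x ≠ 0 →
      (20 * ((k : ℝ) + 1) < ‖zC x‖ → ((f₀ ⟨stereoNorthInv (draw k x), hxO⟩ : CStar) : ℂ) = toC (coLatDir k (zC x))) ∧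
      ((∃ j : Fin k, ‖zC x - holeCentre k j‖ < 27 / 20) → ((f₀ ⟨stereoNorthInv (draw k x), hxO⟩ : CStar) : ℂ) = 1))
    {q : ↥W} (γ : Path q q) (j : Fin k)
    (hγ : ∀ t : I, ∃ z w : ℂ, ‖z - holeCentre k j‖ < 27 / 20 ∧ w ≠ 0 ∧ ofZW z w ∈ modelBoundary k ∧
      ((γ t : ↥W) : sphere (0 : EuclideanSpace ℝ (Fin 4)) 1) = stereoNorthInv (draw k (ofZW z w))) :
    singularHomology.map ℤ ℤ (f₀.comp (subsetInclusion hWO)) 1 (loopClass ℤ ℤ (1 : ℤ) γ) = 0 := by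
  refine geo_map_eq_zero_of_const _ γ 1 fun t => ?_
  obtain ⟨z, w, hnear, hw0, hM, hval⟩ := hγ t
  obtain ⟨hxO, e⟩ := geo_comp_apply hWO f₀ hval
  rw [e]
  exact (hf₀ _ hxO hM (by rw [wC_ofZW]; exact hw0)).2 ⟨j, by rw [zC_ofZW]; exact hnear⟩

/-- **Axis functional on the far fibre circle: `0`** (constant co-latitude direction). [folklore] -/
theorem geo_axis_farFib (hWO : W ⊆ O) (f₀ : C(↥O, CStar))
    (hf₀ : ∀ (x : EuclideanSpace ℝ (Fin 4)) (hxO : stereoNorthInv (draw k x) ∈ O), x ∈ modelBoundary k → wC x ≠ 0 →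
      (20 * ((k : ℝ) + 1) < ‖zC x‖ → ((f₀ ⟨stereoNorthInv (draw k x), hxO⟩ : CStar) : ℂ) = toC (coLatDir k (zC x))) ∧
      ((∃ j : Fin k, ‖zC x - holeCentre k j‖ < 27 / 20) → ((f₀ ⟨stereoNorthInv (draw k x), hxO⟩ : CStar) : ℂ) = 1))
    {q : ↥W} (γ : Path q q) (z₁ : ℂ) (hfar : 20 * ((k : ℝ) + 1) < ‖z₁‖)
    (hγ : ∀ t : I, ∃ w : ℂ, w ≠ 0 ∧ ofZW z₁ w ∈ modelBoundary k ∧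
      ((γ t : ↥W) : sphere (0 : EuclideanSpace ℝ (Fin 4)) 1) = stereoNorthInv (draw k (ofZW z₁ w))) :
    singularHomology.map ℤ ℤ (f₀.comp (subsetInclusion hWO)) 1 (loopClass ℤ ℤ (1 : ℤ) γ) = 0 := by
  refine geo_map_eq_zero_of_const _ γ (toC (coLatDir k z₁)) fun t => ?_
  obtain ⟨w, hw0, hM, hval⟩ := hγ t
  obtain ⟨hxO, e⟩ := geo_comp_apply hWO f₀ hval
  rw [e]
  have := (hf₀ _ hxO hM (by rw [wC_ofZW]; exact hw0)).1 (by rw [zC_ofZW]; exact hfar)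
  rwa [zC_ofZW] at this

/-! ## The planar windings -/

/-- **Winding about `c_j` on the near core-parallel loop of the hole `j`: `2πi`.** [cite: HatcherAT2002, Thm. 1.7] -/
theorem geo_wind_nearPar_self (windJ : C(↥W, CStar)) (j : Fin k)
    (hwJ : ∀ y : ↥W, ((windJ y : CStar) : ℂ) = chartZ k (stereoNorthCoords ((y : sphere (0 : EuclideanSpace ℝ (Fin 4)) 1) : EuclideanSpace ℝ (Fin 4))) - holeCentre k j)
    {q : ↥W} (γ : Path q q)
    (hγ : ∀ t : I, ∃ z w : ℂ, unitDir (holeCentre k j) z = Complex.exp ((2 * Real.pi * t : ℝ) * Complex.I) ∧ w ≠ 0 ∧ ofZW z w ∈ modelBoundary k ∧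
      ((γ t : ↥W) : sphere (0 : EuclideanSpace ℝ (Fin 4)) 1) = stereoNorthInv (draw k (ofZW z w))) :
    windH (singularHomology.map ℤ ℤ windJ 1 (loopClass ℤ ℤ (1 : ℤ) γ)) = 2 * Real.pi * Complex.I := by
  have h := geo_windH_of_arg windJ γ 1 fun t => ?_
  · rw [h]; push_cast; ring
  obtain ⟨z, w, hdir, hw0, hM, hval⟩ := hγ t
  have hv : ((windJ (γ t) : CStar) : ℂ) = z - holeCentre k j := by
    rw [hwJ, hval, pic_coords_P, chartZ_draw hM (by rw [wC_ofZW]; exact hw0), zC_ofZW]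
  have hz : z - holeCentre k j = ((‖z - holeCentre k j‖ : ℝ) : ℂ) * unitDir (holeCentre k j) z := by
    conv_lhs => rw [eq_centre_add_norm_mul_unitDir (holeCentre k j) z]
    ring
  rw [hv]
  conv_lhs => rw [hz, hdir]
  push_cast; ring_nf

/-- **Winding about `c_J` on the near core-parallel loop of another hole `j ≠ J`: `0`** (values in the disc
`B(c_j − c_J, 27/20)`, which misses `0`). [folklore] -/
theorem geo_wind_nearPar_other (windJ : C(↥W, CStar)) (J j : Fin k) (hjJ : j ≠ J)
    (hwJ : ∀ y : ↥W, ((windJ y : CStar) : ℂ) = chartZ k (stereoNorthCoords ((y : sphere (0 : EuclideanSpace ℝ (Fin 4)) 1) : EuclideanSpace ℝ (Fin 4))) - holeCentre k J)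
    {q : ↥W} (γ : Path q q)
    (hγ : ∀ t : I, ∃ z w : ℂ, ‖z - holeCentre k j‖ < 27 / 20 ∧ w ≠ 0 ∧ ofZW z w ∈ modelBoundary k ∧
      ((γ t : ↥W) : sphere (0 : EuclideanSpace ℝ (Fin 4)) 1) = stereoNorthInv (draw k (ofZW z w))) :
    singularHomology.map ℤ ℤ windJ 1 (loopClass ℤ ℤ (1 : ℤ) γ) = 0 := by
  refine geo_map_eq_zero_of_convex windJ γ (ball (holeCentre k j - holeCentre k J) (27 / 20)) (convex_ball _ _) ?_ fun t => ?_
  · rw [mem_ball, dist_eq_norm, zero_sub, norm_neg]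
    have := four_le_norm_holeCentre_sub (k := k) hjJ
    linarith
  · obtain ⟨z, w, hnear, hw0, hM, hval⟩ := hγ t
    rw [hwJ, hval, pic_coords_P, chartZ_draw hM (by rw [wC_ofZW]; exact hw0), zC_ofZW, mem_ball, dist_eq_norm]
    have : z - holeCentre k J - (holeCentre k j - holeCentre k J) = z - holeCentre k j := by ring
    rw [this]; exact hnear

/-- **Winding about `c_J` on a fibre circle: `0`** (constant `z`). [folklore] -/
theorem geo_wind_fib (windJ : C(↥W, CStar)) (J : Fin k)
    (hwJ : ∀ y : ↥W, ((windJ y : CStar) : ℂ) = chartZ k (stereoNorthCoords ((y : sphere (0 : EuclideanSpace ℝ (Fin 4)) 1) : EuclideanSpace ℝ (Fin 4))) - holeCentre k J)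
    {q : ↥W} (γ : Path q q) (z₁ : ℂ)
    (hγ : ∀ t : I, ∃ w : ℂ, w ≠ 0 ∧ ofZW z₁ w ∈ modelBoundary k ∧
      ((γ t : ↥W) : sphere (0 : EuclideanSpace ℝ (Fin 4)) 1) = stereoNorthInv (draw k (ofZW z₁ w))) :
    singularHomology.map ℤ ℤ windJ 1 (loopClass ℤ ℤ (1 : ℤ) γ) = 0 := by
  refine geo_map_eq_zero_of_const windJ γ (z₁ - holeCentre k J) fun t => ?_
  obtain ⟨w, hw0, hM, hval⟩ := hγ t
  rw [hwJ, hval, pic_coords_P, chartZ_draw hM (by rw [wC_ofZW]; exact hw0), zC_ofZW]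

/-! ## The revolution functionals -/

/-- **Revolution functional of the hole `j` on its fibre circle: winding `−2πi`.** [cite: HatcherAT2002, Thm. 1.7] -/
theorem geo_rev_nearFib_self (hε : 0 < ε) (hWO : W ⊆ O) (j : Fin k) (f : C(↥O, CStar))
    (hf : ∀ (x : EuclideanSpace ℝ (Fin 4)) (hxO : stereoNorthInv (draw k x) ∈ O), x ∈ modelBoundary k → wC x ≠ 0 →
      (‖zC x - holeCentre k j‖ < 27 / 20 → ((f ⟨stereoNorthInv (draw k x), hxO⟩ : CStar) : ℂ) = conj (unitDir 0 (wC x))) ∧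
      (27 / 20 ≤ ‖zC x - holeCentre k j‖ → ((f ⟨stereoNorthInv (draw k x), hxO⟩ : CStar) : ℂ) = 1))
    {q : ↥W} (γ : Path q q) (z₁ : ℂ) (hnear : ‖z₁ - holeCentre k j‖ < 27 / 20)
    (hγ : ∀ t : I, ofZW z₁ (((Real.sqrt ε / 2 : ℝ) : ℂ) * Complex.exp ((2 * Real.pi * t : ℝ) * Complex.I)) ∈ modelBoundary k ∧
      ((γ t : ↥W) : sphere (0 : EuclideanSpace ℝ (Fin 4)) 1) =
        stereoNorthInv (draw k (ofZW z₁ (((Real.sqrt ε / 2 : ℝ) : ℂ) * Complex.exp ((2 * Real.pi * t : ℝ) * Complex.I))))) :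
    windH (singularHomology.map ℤ ℤ (f.comp (subsetInclusion hWO)) 1 (loopClass ℤ ℤ (1 : ℤ) γ)) = 2 * Real.pi * (-1 : ℤ) * Complex.I := by
  refine geo_windH_of_arg (f.comp (subsetInclusion hWO)) γ (-1) fun t => ?_
  obtain ⟨hM, hval⟩ := hγ t
  obtain ⟨hxO, e⟩ := geo_comp_apply hWO f hval
  obtain ⟨hu, hw0⟩ := (geo_half_sqrt hε).2.2 (2 * Real.pi * t)
  have hv := (hf _ hxO hM (by rw [wC_ofZW]; exact hw0)).1 (by rw [zC_ofZW]; exact hnear)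
  rw [wC_ofZW, hu, ← Complex.exp_conj, map_mul, Complex.conj_ofReal, Complex.conj_I, mul_neg, ← neg_mul] at hv
  rw [e, hv, ← Complex.ofReal_neg, Complex.norm_exp_ofReal_mul_I]
  push_cast; ring_nf

/-- **Revolution functional of the hole `j` on a loop of pictures of points at distance `≥ 27/20` from `c_j`:
`0`** (the functional is `1` there). [folklore] -/
theorem geo_rev_away (hWO : W ⊆ O) (j : Fin k) (f : C(↥O, CStar))
    (hf : ∀ (x : EuclideanSpace ℝ (Fin 4)) (hxO : stereoNorthInv (draw k x) ∈ O), x ∈ modelBoundary k → wC x ≠ 0 →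
      (‖zC x - holeCentre k j‖ < 27 / 20 → ((f ⟨stereoNorthInv (draw k x), hxO⟩ : CStar) : ℂ) = conj (unitDir 0 (wC x))) ∧
      (27 / 20 ≤ ‖zC x - holeCentre k j‖ → ((f ⟨stereoNorthInv (draw k x), hxO⟩ : CStar) : ℂ) = 1))
    {q : ↥W} (γ : Path q q)
    (hγ : ∀ t : I, ∃ z w : ℂ, 27 / 20 ≤ ‖z - holeCentre k j‖ ∧ w ≠ 0 ∧ ofZW z w ∈ modelBoundary k ∧
      ((γ t : ↥W) : sphere (0 : EuclideanSpace ℝ (Fin 4)) 1) = stereoNorthInv (draw k (ofZW z w))) :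
    singularHomology.map ℤ ℤ (f.comp (subsetInclusion hWO)) 1 (loopClass ℤ ℤ (1 : ℤ) γ) = 0 := by
  refine geo_map_eq_zero_of_const _ γ 1 fun t => ?_
  obtain ⟨z, w, haway, hw0, hM, hval⟩ := hγ t
  obtain ⟨hxO, e⟩ := geo_comp_apply hWO f hval
  rw [e]
  exact (hf _ hxO hM (by rw [wC_ofZW]; exact hw0)).2 (by rw [zC_ofZW]; exact haway)

/-- **Revolution functional of the hole `j` on the near core-parallel loop of the hole `j`: `0`** (the loop has
real positive `w = √ε/2`, so the functional is constantly `1`). [folklore] -/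
theorem geo_rev_nearPar_self (hε : 0 < ε) (hWO : W ⊆ O) (j : Fin k) (f : C(↥O, CStar))
    (hf : ∀ (x : EuclideanSpace ℝ (Fin 4)) (hxO : stereoNorthInv (draw k x) ∈ O), x ∈ modelBoundary k → wC x ≠ 0 →
      (‖zC x - holeCentre k j‖ < 27 / 20 → ((f ⟨stereoNorthInv (draw k x), hxO⟩ : CStar) : ℂ) = conj (unitDir 0 (wC x))) ∧
      (27 / 20 ≤ ‖zC x - holeCentre k j‖ → ((f ⟨stereoNorthInv (draw k x), hxO⟩ : CStar) : ℂ) = 1))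
    {q : ↥W} (γ : Path q q)
    (hγ : ∀ t : I, ∃ z : ℂ, ‖z - holeCentre k j‖ < 27 / 20 ∧ ofZW z ((Real.sqrt ε / 2 : ℝ) : ℂ) ∈ modelBoundary k ∧
      ((γ t : ↥W) : sphere (0 : EuclideanSpace ℝ (Fin 4)) 1) = stereoNorthInv (draw k (ofZW z ((Real.sqrt ε / 2 : ℝ) : ℂ)))) :
    singularHomology.map ℤ ℤ (f.comp (subsetInclusion hWO)) 1 (loopClass ℤ ℤ (1 : ℤ) γ) = 0 := by
  refine geo_map_eq_zero_of_const _ γ 1 fun t => ?_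
  obtain ⟨z, hnear, hM, hval⟩ := hγ t
  obtain ⟨hxO, e⟩ := geo_comp_apply hWO f hval
  obtain ⟨hw0, h1, -⟩ := geo_half_sqrt hε
  rw [e, (hf _ hxO hM (by rw [wC_ofZW]; exact hw0)).1 (by rw [zC_ofZW]; exact hnear), wC_ofZW, h1, map_one]

end FriendsCarrierVk

open FriendsCarrierVk in
/-- **Piece 7 of part I of V_k part A: values of the detecting functionals on the collar generators** (three
representative cases: the axis functional winds once along the far core-parallel loop, the planar winding about
`c_j` winds once along the near core-parallel loop of the hole `j`, the revolution functional of the hole `j`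
winds minus once along its fibre circle). [cite: HatcherAT2002, §2.2] -/
theorem helper_friendsCarrier_Vk_partA_partI_geoValues : ∀ (k : ℕ) (ε : ℝ), 0 < ε → ∀ (W O : Set (sphere (0 : EuclideanSpace ℝ (Fin 4)) 1)) (hWO : W ⊆ O) (q : ↥W) (γ : Path q q), (∀ (f₀ : C(↥O, CStar)), (∀ (x : EuclideanSpace ℝ (Fin 4)) (hxO : stereoNorthInv (draw k x) ∈ O), x ∈ modelBoundary k → wC x ≠ 0 → (20 * ((k : ℝ) + 1) < ‖zC x‖ → ((f₀ ⟨stereoNorthInv (draw k x), hxO⟩ : CStar) : ℂ) = toC (coLatDir k (zC x))) ∧ ((∃ j : Fin k, ‖zC x - holeCentre k j‖ < 27 / 20) → ((f₀ ⟨stereoNorthInv (draw k x), hxO⟩ : CStar) : ℂ) = 1)) → (∀ t : unitInterval, ∃ z : ℂ, 20 * ((k : ℝ) + 1) < ‖z‖ ∧ coLatDir k z = toE2 (Complex.exp ((2 * Real.pi * t : ℝ) * Complex.I)) ∧ ofZW z ((Real.sqrt ε / 2 : ℝ) : ℂ) ∈ modelBoundary k ∧ ((γ t : ↥W) : sphere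 (0 : EuclideanSpace ℝ (Fin 4)) 1) = stereoNorthInv (draw k (ofZW z ((Real.sqrt ε / 2 : ℝ) : ℂ)))) → windH (singularHomology.map ℤ ℤ (f₀.comp (subsetInclusion hWO)) 1 (loopClass ℤ ℤ (1 : ℤ) γ)) = 2 * Real.pi * Complex.I) ∧ (∀ (j : Fin k) (windJ : C(↥W, CStar)), (∀ y : ↥W, ((windJ y : CStar) : ℂ) = chartZ k (stereoNorthCoords ((y : sphere (0 : EuclideanSpace ℝ (Fin 4)) 1) : EuclideanSpace ℝ (Fin 4))) - holeCentre k j) → (∀ t : unitInterval, ∃ z w : ℂ, unitDir (holeCentre k j) z = Complex.exp ((2 * Real.pi * t : ℝ) * Complex.I) ∧ w ≠ 0 ∧ ofZW z w ∈ modelBoundary k ∧ ((γ t : ↥W) : sphere (0 : EuclideanSpace ℝ (Fin 4)) 1) = stereoNorthInv (draw k (ofZW z w))) → windH (singularHomology.map ℤ ℤ windJ 1 (loopClass ℤ ℤ (1 : ℤ) γ)) = 2 * Real.pi * Complex.I) ∧ ∀ (j : Fin k) (f : C(↥O, CStar)) (z₁ : ℂ), (∀ (x : EuclideanSpace ℝ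 (Fin 4)) (hxO : stereoNorthInv (draw k x) ∈ O), x ∈ modelBoundary k → wC x ≠ 0 → (‖zC x - holeCentre k j‖ < 27 / 20 → ((f ⟨stereoNorthInv (draw k x), hxO⟩ : CStar) : ℂ) = conj (unitDir 0 (wC x))) ∧ (27 / 20 ≤ ‖zC x - holeCentre k j‖ → ((f ⟨stereoNorthInv (draw k x), hxO⟩ : CStar) : ℂ) = 1)) → ‖z₁ - holeCentre k j‖ < 27 / 20 → (∀ t : unitInterval, ofZW z₁ (((Real.sqrt ε / 2 : ℝ) : ℂ) * Complex.exp ((2 * Real.pi * t : ℝ) * Complex.I)) ∈ modelBoundary k ∧ ((γ t : ↥W) : sphere (0 : EuclideanSpace ℝ (Fin 4)) 1) = stereoNorthInv (draw k (ofZW z₁ (((Real.sqrt ε / 2 : ℝ) : ℂ) * Complex.exp ((2 * Real.pi * t : ℝ) * Complex.I))))) → windH (singularHomology.map ℤ ℤ (f.comp (subsetInclusion hWO)) 1 (loopClass ℤ ℤ (1 : ℤ) γ)) = 2 * Real.pi * (-1 : ℤ) * Complex.I :=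
  fun _ _ hε _ _ hWO _ γ => ⟨fun f₀ hf₀ hγ => geo_axis_farPar hε hWO f₀ hf₀ γ hγ, fun j windJ hwJ hγ => geo_wind_nearPar_self windJ j hwJ γ hγ,
    fun j f z₁ hf hnear hγ => geo_rev_nearFib_self hε hWO j f hf γ z₁ hnear hγ⟩

end Summit.SmoothPoincare4.SmoothPoincare4.Theorems.DcrGap.MkFriends
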